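import Summits.CriticalPhenomena.Ising3DConformalLimit.Theorems.LeeYangGapGaussianLimitKillsBlockCouplingDoubling
import Summits.CriticalPhenomena.Ising3DConformalLimit.Theorems.LeeYangGapGaussianLimitKillsBlockCoupling
import Literature.Probability.LatticeModels.RescaledUrsellUniformOnCompact
import Literature.Probability.LatticeModels.CriticalUrsellFourSign
import Literature.Probability.LatticeModels.CriticalBlockMoments

/-!
# Summit descent for `LeeYangGap` (2/3): the block two-point sum `Σ_L` under a scaling limit

Route `LeeYangGap` (CriticalPhenomena / Ising3DConformalLimit), crux `NearCriticalLeeYangGap`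
(stmt-CriticalPhenomena-4945), redirect strategist r1.  Part 2 of the kernel-checked descent
`Ising3DConformalLimit → NearCriticalLeeYangGap` (assembled in `LeeYangGapSummitDescent.lean`).

`blockSum_upper`: if `criticalCorr 3` has a pointwise scaling limit `S` with renormalisation `ρ > 0` on
`(0,1]`, non-degenerate two-point function and scale covariance, then for all large `L`
`ρ(1/L)² Σ_{a,b ∈ Λ_L} ⟨σ_aσ_b⟩_{β_c} ≤ C L⁶`.

Proof. `Σ_L ≤ |Λ_L| χ(2L)` (rows are translates, `row_le_boxSum_two_mul`) and
`χ(2L) ≤ 2 Σ_{ηL < ‖z‖_∞ ≤ 2L} G(z)` by the doubling lemma `exists_eta_boxSum_floor_le` of the support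
`GaussianLimitKillsBlockCoupling` (short distances do not dominate `χ`); the far terms are read at mesh
`1/L` on the compact annulus of pairs `(0, y)`, `η ≤ ‖y‖`, `|y_k| ≤ 2`, where `ρ(1/L)² G(z) ≤ B + 1` by
uniform convergence of the rescaled pair function (`HasPointwiseScalingLimit` at `n = 2`,
`exists_forall_abs_le_of_tendstoUniformlyOn`).

## References

* M. Aizenman, Comm. Math. Phys. 86 (1982), §1, Prop. 5.3 (sign of `U₄`, block criterion) [Aizenman1982].
* M. Aizenman, H. Duminil-Copin, Ann. Math. 194 (2021), Prop. 1.4 [AizenmanDuminilCopinAnnals2021].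
* C. M. Newman, Comm. Math. Phys. 41 (1975), Thm 3 and (6) [Newman1975].
-/

noncomputable section

namespace Summit.CriticalPhenomena.Ising3DConformalLimit.LeeYangGapSummitDescent

open Literature.Probability.LatticeModels Filter Set Finset
open scoped Topology BigOperators


/-! ### The mesh `δ = 1/L` -/

/-- The mesh `δ = 1/L` tends to `0⁺` along `L → ∞` (copy of the Part 1 lemma, so that Parts 1 and 2
are independent files). -/
theorem tendsto_one_div_nat' : Tendsto (fun L : ℕ => 1 / (L : ℝ)) atTop (𝓝[>] (0 : ℝ)) := by
  rw [tendsto_nhdsWithin_iff]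
  refine ⟨tendsto_one_div_atTop_nhds_zero_nat, ?_⟩
  filter_upwards [eventually_ge_atTop 1] with L hL
  have : (0 : ℝ) < L := by exact_mod_cast hL
  exact Set.mem_Ioi.2 (by positivity)

/-! ### Denominator: `ρ(1/L)² Σ_L ≤ C L⁶` -/

/-- Row sums of the block two-point sum are bounded by `χ(2L)`. -/
theorem row_le_boxSum_two_mul (L : ℕ) {a : Site 3} (ha : a ∈ box 3 L) :
    ∑ b ∈ box 3 L, criticalCorr 3 2 ![a, b] ≤ ∑ z ∈ box 3 (2 * L), criticalTwoPoint 3 z := by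
  classical
  have h1 : ∑ b ∈ box 3 L, criticalCorr 3 2 ![a, b] =
      ∑ z ∈ (box 3 L).image (· - a), criticalTwoPoint 3 z := by
    rw [Finset.sum_image (fun v _ w _ h => sub_left_injective h)]
    exact Finset.sum_congr rfl fun v _ => criticalCorr_two_pair a v
  have h2 : (box 3 L).image (· - a) ⊆ box 3 (2 * L) := by
    intro z hz
    obtain ⟨v, hv, rfl⟩ := Finset.mem_image.1 hz
    rw [mem_box] at hv ha ⊢
    intro i
    have hv' := hv i
    have ha' := ha i
    simp only [Pi.sub_apply]
    push_cast
    omega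
  rw [h1]
  exact Finset.sum_le_sum_of_subset_of_nonneg h2 fun z _ _ => criticalTwoPoint_nonneg' z

/-- **Denominator upper bound.** Under a pointwise scaling limit with `ρ > 0` on `(0,1]`, non-degenerate
two-point function and scale covariance: `ρ(1/L)² Σ_L ≤ C L⁶` for all large `L`. -/
theorem blockSum_upper {ρ : ℝ → ℝ} {Δ : ℝ} {S : CorrFamily 3}
    (hρ : ∀ δ ∈ Set.Ioc (0:ℝ) 1, 0 < ρ δ)
    (hlim : HasPointwiseScalingLimit (criticalCorr 3) ρ S) (hnd : IsNondegenerateTwoPoint S)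
    (hsc : IsScaleCovariant Δ S) :
    ∃ C : ℝ, 0 < C ∧ ∀ᶠ L : ℕ in atTop,
      ρ (1 / (L : ℝ)) ^ 2 * ∑ a ∈ box 3 L, ∑ b ∈ box 3 L, criticalCorr 3 2 ![a, b] ≤ C * (L : ℝ) ^ 6 := by
  classical
  have hd : 3 ≤ 3 := le_rfl
  -- short distances do not dominate `χ`
  obtain ⟨η, hη, hη1, hηev⟩ :=
    LeeYangGapGaussianLimitKillsBlockCoupling.exists_eta_boxSum_floor_le hρ hlim hnd hsc
      (ε := 1 / 2) (by norm_num)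
  have h4L : Tendsto (fun L : ℕ => 4 * L) atTop atTop :=
    tendsto_atTop_mono (fun L => by change L ≤ 4 * L; omega) tendsto_id
  have hηev4 := h4L.eventually hηev
  -- the compact annulus of pairs `(0, y)`, `η ≤ ‖y‖`, `|y_k| ≤ 2`
  set Cann : Set (EuclideanSpace ℝ (Fin 3)) :=
    (WithLp.toLp 2) '' (Set.pi Set.univ fun _ : Fin 3 => Set.Icc (-2 : ℝ) 2) ∩ {y | η ≤ ‖y‖} with hCann
  have hCannc : IsCompact Cann :=
    ((isCompact_univ_pi fun _ => isCompact_Icc).image (PiLp.continuous_toLp 2 _)).inter_right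
      (isClosed_le continuous_const continuous_norm)
  set g : EuclideanSpace ℝ (Fin 3) → (Fin 2 → EuclideanSpace ℝ (Fin 3)) := fun y => ![0, y] with hg
  have hgc : Continuous g := continuous_const.matrixVecCons (continuous_id.matrixVecCons continuous_const)
  set K₂ : Set (Fin 2 → EuclideanSpace ℝ (Fin 3)) := g '' Cann with hK₂
  have hK₂c : IsCompact K₂ := hCannc.image hgc
  have hK₂s : K₂ ⊆ NonCoincident 3 2 := by
    rintro _ ⟨y, hy, rfl⟩
    refine pair_mem_nonCoincident fun h0 => ?_
    have h1 : η ≤ ‖y‖ := hy.2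
    rw [← h0, norm_zero] at h1
    linarith
  have hU2 : TendstoUniformlyOn (rescaledCorrelator (criticalCorr 3) ρ 2) (S 2) (𝓝[>] (0:ℝ)) K₂ :=
    (tendstoLocallyUniformlyOn_iff_forall_isCompact (isOpen_nonCoincident 3 2)).1 (hlim 2) K₂ hK₂s hK₂c
  obtain ⟨B, hB0, hB⟩ := exists_forall_abs_le_of_tendstoUniformlyOn hU2 fun δ => ⟨ρ δ ^ 2, fun p _ => by
    rw [rescaledCorrelator_apply, abs_mul, abs_of_nonneg (sq_nonneg _)]
    exact mul_le_of_le_one_right (sq_nonneg _) (abs_criticalCorr_le_one hd _ _)⟩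
  have hev1 : ∀ᶠ δ in 𝓝[>] (0:ℝ), ∀ p ∈ K₂, dist (S 2 p) (rescaledCorrelator (criticalCorr 3) ρ 2 δ p) < 1 :=
    Metric.tendstoUniformlyOn_iff.1 hU2 1 one_pos
  have hevL := tendsto_one_div_nat'.eventually hev1
  refine ⟨6750 * (B + 1), by positivity, ?_⟩
  filter_upwards [hevL, hηev4, eventually_ge_atTop 1] with L hL hLη hL1
  have hLpos : (0 : ℝ) < L := by exact_mod_cast hL1
  have hδpos : (0 : ℝ) < 1 / (L : ℝ) := by positivity
  have hB1 : 0 ≤ B + 1 := by linarith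
  -- notation
  set χ : ℕ → ℝ := fun m => ∑ z ∈ box 3 m, criticalTwoPoint 3 z with hχ
  have hχnn : ∀ m, 0 ≤ χ m := fun m => Finset.sum_nonneg fun z _ => criticalTwoPoint_nonneg' z
  -- the far two-point values at mesh `1/L`
  have hfar : ∀ z : Site 3, z ∈ box 3 (2 * L) → z ∉ box 3 ⌊η * L⌋₊ →
      ρ (1 / (L : ℝ)) ^ 2 * criticalTwoPoint 3 z ≤ B + 1 := by
    intro z hz hzn
    set y : EuclideanSpace ℝ (Fin 3) := (1 / (L : ℝ)) • siteVec z with hy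
    have hyk : ∀ k, y k = (z k : ℝ) / L := fun k => by
      simp [hy, PiLp.smul_apply, smul_eq_mul, div_eq_inv_mul]
    have hyC : y ∈ Cann := by
      refine ⟨⟨fun k => y k, ?_, rfl⟩, ?_⟩
      · simp only [Set.mem_univ_pi, Set.mem_Icc]
        rw [mem_box] at hz
        intro k
        rw [hyk, le_div_iff₀ hLpos, div_le_iff₀ hLpos]
        have h := (hz k).1
        have h' : (-(((2 * L : ℕ)) : ℤ) : ℝ) ≤ z k := by exact_mod_cast h
        have h2 := (hz k).2
        have h2' : ((z k : ℤ) : ℝ) ≤ ((2 * L : ℕ) : ℤ) := by exact_mod_cast h2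
        push_cast at h' h2'
        constructor <;> linarith
      · -- `η ≤ ‖y‖`: some coordinate of `z` exceeds `⌊ηL⌋`
        show η ≤ ‖y‖
        rw [mem_box] at hzn
        push Not at hzn
        obtain ⟨k, hk⟩ := hzn
        have hzk : (⌊η * L⌋₊ : ℝ) + 1 ≤ |(z k : ℝ)| := by
          have h' : (⌊η * L⌋₊ : ℤ) + 1 ≤ |z k| := by
            rcases le_or_gt (-(⌊η * L⌋₊ : ℤ)) (z k) with h | h
            · have := hk h
              rw [abs_of_nonneg (by omega)]
              omega
            · rw [abs_of_neg (by omega)]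
              omega
          exact_mod_cast h'
        have hηL : η * L < ⌊η * L⌋₊ + 1 := Nat.lt_floor_add_one _
        have hyk' : η ≤ |y k| := by
          rw [hyk, abs_div, abs_of_pos hLpos, le_div_iff₀ hLpos]
          linarith
        exact hyk'.trans (by simpa [Real.norm_eq_abs] using PiLp.norm_apply_le y k)
    have hp : g y ∈ K₂ := ⟨y, hyC, rfl⟩
    have h1 := hL (g y) hp
    have hval : rescaledCorrelator (criticalCorr 3) ρ 2 (1 / (L : ℝ)) (g y) =
        ρ (1 / (L : ℝ)) ^ 2 * criticalTwoPoint 3 z := by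
      rw [rescaledCorrelator_apply, latticeApprox_comp_two]
      simp only [hg, Matrix.cons_val_zero, Matrix.cons_val_one]
      rw [latticeApprox_zero, hy, latticeApprox_smul_siteVec hδpos, criticalCorr_two_pair, sub_zero]
    rw [hval, Real.dist_eq] at h1
    have h1' := abs_sub_lt_iff.1 h1
    have hBp := hB (g y) hp
    have hBp' := (abs_le.1 hBp).2
    linarith [h1'.1, h1'.2]
  -- `χ(2L) ≤ 2 · |Λ_{2L}| (B+1) ρ(1/L)⁻²`
  have hn2L : ⌊η * L⌋₊ ≤ 2 * L := by
    have h1 : (⌊η * L⌋₊ : ℝ) ≤ η * L := Nat.floor_le (by positivity)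
    have h2 : η * L ≤ 2 * L := by nlinarith
    exact_mod_cast h1.trans h2
  have hsub : box 3 ⌊η * L⌋₊ ⊆ box 3 (2 * L) := box_mono 3 hn2L
  have hsplit := Finset.sum_sdiff hsub (f := fun z => criticalTwoPoint 3 z)
  have hhalf : χ ⌊η * L⌋₊ ≤ 1 / 2 * χ (2 * L) := by
    have h1 : χ ⌊η * L⌋₊ ≤ χ ⌊η * ((4 * L : ℕ) : ℝ)⌋₊ := by
      refine Finset.sum_le_sum_of_subset_of_nonneg (box_mono 3 (Nat.floor_le_floor ?_))
        fun z _ _ => criticalTwoPoint_nonneg' z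
      push_cast; nlinarith
    have h2 : (4 * L) / 2 = 2 * L := by omega
    have h3 := hLη
    rw [h2] at h3
    exact h1.trans h3
  have hshell : ∑ z ∈ box 3 (2 * L) \ box 3 ⌊η * L⌋₊, ρ (1 / (L : ℝ)) ^ 2 * criticalTwoPoint 3 z ≤
      (#(box 3 (2 * L)) : ℝ) * (B + 1) := by
    calc ∑ z ∈ box 3 (2 * L) \ box 3 ⌊η * L⌋₊, ρ (1 / (L : ℝ)) ^ 2 * criticalTwoPoint 3 z
        ≤ ∑ _z ∈ box 3 (2 * L) \ box 3 ⌊η * L⌋₊, (B + 1) :=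
          Finset.sum_le_sum fun z hz => hfar z (Finset.mem_sdiff.1 hz).1 (Finset.mem_sdiff.1 hz).2
      _ = (#(box 3 (2 * L) \ box 3 ⌊η * L⌋₊) : ℝ) * (B + 1) := by
          rw [Finset.sum_const, nsmul_eq_mul]
      _ ≤ (#(box 3 (2 * L)) : ℝ) * (B + 1) :=
          mul_le_mul_of_nonneg_right (by exact_mod_cast Finset.card_le_card Finset.sdiff_subset) hB1
  have hχ2L : ρ (1 / (L : ℝ)) ^ 2 * χ (2 * L) ≤ 2 * ((#(box 3 (2 * L)) : ℝ) * (B + 1)) := by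
    have h1 : χ (2 * L) = ∑ z ∈ box 3 (2 * L) \ box 3 ⌊η * L⌋₊, criticalTwoPoint 3 z + χ ⌊η * L⌋₊ := by
      simp only [hχ]; rw [hsplit]
    have h2 : χ (2 * L) ≤ 2 * ∑ z ∈ box 3 (2 * L) \ box 3 ⌊η * L⌋₊, criticalTwoPoint 3 z := by
      linarith
    have hρ2 : 0 ≤ ρ (1 / (L : ℝ)) ^ 2 := sq_nonneg _
    calc ρ (1 / (L : ℝ)) ^ 2 * χ (2 * L)
        ≤ ρ (1 / (L : ℝ)) ^ 2 * (2 * ∑ z ∈ box 3 (2 * L) \ box 3 ⌊η * L⌋₊, criticalTwoPoint 3 z) :=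
          mul_le_mul_of_nonneg_left h2 hρ2
      _ = 2 * ∑ z ∈ box 3 (2 * L) \ box 3 ⌊η * L⌋₊, ρ (1 / (L : ℝ)) ^ 2 * criticalTwoPoint 3 z := by
          simp only [Finset.mul_sum]
          exact Finset.sum_congr rfl fun z _ => by ring
      _ ≤ 2 * ((#(box 3 (2 * L)) : ℝ) * (B + 1)) := by linarith [hshell]
  -- `Σ_L ≤ |Λ_L| χ(2L)`
  have hSig : ∑ a ∈ box 3 L, ∑ b ∈ box 3 L, criticalCorr 3 2 ![a, b] ≤ (#(box 3 L) : ℝ) * χ (2 * L) := by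
    calc ∑ a ∈ box 3 L, ∑ b ∈ box 3 L, criticalCorr 3 2 ![a, b] ≤ ∑ _a ∈ box 3 L, χ (2 * L) :=
          Finset.sum_le_sum fun a ha => row_le_boxSum_two_mul L ha
      _ = (#(box 3 L) : ℝ) * χ (2 * L) := by rw [Finset.sum_const, nsmul_eq_mul]
  -- cardinalities
  have hc1 : (#(box 3 L) : ℝ) ≤ 27 * (L : ℝ) ^ 3 := by
    rw [card_box]; push_cast
    have : (2 * (L : ℝ) + 1) ≤ 3 * L := by linarith [show (1 : ℝ) ≤ L by exact_mod_cast hL1]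
    calc (2 * (L : ℝ) + 1) ^ 3 ≤ (3 * (L : ℝ)) ^ 3 := pow_le_pow_left₀ (by positivity) this 3
      _ = 27 * (L : ℝ) ^ 3 := by ring
  have hc2 : (#(box 3 (2 * L)) : ℝ) ≤ 125 * (L : ℝ) ^ 3 := by
    rw [card_box]; push_cast
    have : (2 * (2 * (L : ℝ)) + 1) ≤ 5 * L := by linarith [show (1 : ℝ) ≤ L by exact_mod_cast hL1]
    calc (2 * (2 * (L : ℝ)) + 1) ^ 3 ≤ (5 * (L : ℝ)) ^ 3 := pow_le_pow_left₀ (by positivity) this 3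
      _ = 125 * (L : ℝ) ^ 3 := by ring
  have hρ2 : 0 ≤ ρ (1 / (L : ℝ)) ^ 2 := sq_nonneg _
  calc ρ (1 / (L : ℝ)) ^ 2 * ∑ a ∈ box 3 L, ∑ b ∈ box 3 L, criticalCorr 3 2 ![a, b]
      ≤ ρ (1 / (L : ℝ)) ^ 2 * ((#(box 3 L) : ℝ) * χ (2 * L)) := mul_le_mul_of_nonneg_left hSig hρ2
    _ = (#(box 3 L) : ℝ) * (ρ (1 / (L : ℝ)) ^ 2 * χ (2 * L)) := by ring
    _ ≤ (27 * (L : ℝ) ^ 3) * (2 * ((125 * (L : ℝ) ^ 3) * (B + 1))) := by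
        refine mul_le_mul hc1 (hχ2L.trans ?_) (mul_nonneg hρ2 (hχnn _)) (by positivity)
        exact mul_le_mul_of_nonneg_left (mul_le_mul_of_nonneg_right hc2 hB1) (by norm_num)
    _ = 6750 * (B + 1) * (L : ℝ) ^ 6 := by ring

end Summit.CriticalPhenomena.Ising3DConformalLimit.LeeYangGapSummitDescent

end
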